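import Summits.QuantumFields.BalabanUV.T4Continuum.Support.LatticeCosineProfile

/-!
# T⁴ programme, spine node NE2 (U1a) — lattice trigonometry for `x`-dependent witnesses, II: the BACKWARD lattice step of the profile
# `cos(2π·val/m)` and the two-level consistency of its LATTICE DERIVATIVE `n·(c(x) − c(x − e))` across the block hierarchy

NE2 formalisation swarm `b2b-balaban-t4-ne2-formalise-*`, leaf prover 03 (row B5 lineage; support row «B7.w END WITNESSES», supplier of the fourth
file `Spine/NE2BalabanLongWaveWitness` — the LONGITUDINAL wave, whose lattice-derivative tower `D_νw_ν` is NOT zero).  Contents: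
 * `ang m a = 2π·val(a)/m` (`cang m a = cos (ang m a)`), **`cang_sub_one`**: `c(a − 1) = cos(ang a − 2π/m)` (torus wrap-around absorbed; `m = 1` included);
 * `abs_ang_sub_ang_par_le`: the fine angle at `x′` and the coarse angle at the block parent `par x′` differ by `≤ 2π/(n·M_{μ₀})` (owner's `val_par`);
 * `abs_sin_sub_self_le`: `|sin u − u| ≤ u³/6` for `u ≥ 0` (Mathlib's `Real.sin_le`, `Real.sin_gt_sub_cube`); `abs_sin_le_abs`;
 * **`abs_dmain_sub_le`**: for `0 < Ω`, `1 ≤ n ≤ n′`, `|A′ − A| ≤ Ω/n`: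
   `|n′·(cos A′ − cos(A′ − Ω/n′)) − n·(cos A − cos(A − Ω/n))| ≤ (Ω³/12 + 3Ω²/2)/n`
   (product formula `cos x − cos y = −2 sin((x+y)/2) sin((x−y)/2)`, `|sin a − sin b| ≤ |a − b|`) — the main term of the lattice derivative of the
   profile is two-level consistent with rate `n⁻¹`.

HONEST FRAMING (T4-DAG p. 1).  Elementary real analysis ∕ `ZMod` bookkeeping; OURS; no physics; NE2 NOT proved; spine 0/9; NOT infinite volume ∕ mass
gap ∕ Clay.  HONEST DEPENDENCY: continuum YM on T⁴ ⇐ BetaPertH ∧ nine spine estimates (0/9 proved); BetaPertH ⇐ (D1) ∧ (D4) ∧ CAP+tail; G-an2-4 gates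
asym, D1 and NE2/3/4.  ABSOLUTE RULE kept; no `sorry`.
-/

noncomputable section

open Real

namespace Summit.QuantumFields.BalabanUV.T4Continuum.LatticeCosineProfileDiff

open Literature.MathematicalPhysics.QuantumFieldTheory.Balaban1983to89.B5Prop11Plancherel (Tor fine)
open Summit.QuantumFields.BalabanUV.T4Continuum.BalabanAveragedTowerModes (par val_par)
open Summit.QuantumFields.BalabanUV.T4Continuum.LatticeCosineProfile

/-! ## §1 The angle, the backward step and the block parent -/

/-- the lattice angle `ang m a = 2π·val(a)/m`. [folklore] -/
def ang (m : ℕ) (a : ZMod m) : ℝ := 2 * π * (a.val : ℝ) / m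

/-- `cang = cos ∘ ang`. [folklore] -/
theorem cang_eq_cos_ang (m : ℕ) (a : ZMod m) : cang m a = Real.cos (ang m a) := rfl

/-- **THE BACKWARD LATTICE STEP**: `c(a − 1) = cos(ang a − 2π/m)` on `ZMod m` (`m ≥ 1`; wrap-around absorbed by periodicity). [folklore] -/
theorem cang_sub_one (m : ℕ) [NeZero m] (a : ZMod m) : cang m (a - 1) = Real.cos (ang m a - 2 * π / m) := by
  have hm0 : (m : ℝ) ≠ 0 := by exact_mod_cast NeZero.ne m
  -- `val a = (val (a-1) + val 1) % m`, so `val (a-1) + val 1 = m·q + val a`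
  set s : ℕ := (a - 1).val + (1 : ZMod m).val with hs
  have hmod : s % m = a.val := by rw [hs, ← ZMod.val_add, sub_add_cancel]
  have hdecomp : ((a - 1).val : ℝ) = (m : ℝ) * ((s / m : ℕ) : ℝ) + (a.val : ℝ) - ((1 : ZMod m).val : ℝ) := by
    have h := Nat.div_add_mod s m
    rw [hmod] at h
    have h' : (m : ℝ) * ((s / m : ℕ) : ℝ) + (a.val : ℝ) = (s : ℝ) := by exact_mod_cast h
    have hs' : (s : ℝ) = ((a - 1).val : ℝ) + ((1 : ZMod m).val : ℝ) := by rw [hs]; push_cast; ring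
    linarith
  have e : 2 * π * ((a - 1).val : ℝ) / m = (ang m a - 2 * π * ((1 : ZMod m).val : ℝ) / m) + ((s / m : ℕ) : ℝ) * (2 * π) := by
    rw [hdecomp, ang]; field_simp; ring
  unfold cang
  rw [e, Real.cos_add_nat_mul_two_pi]
  -- `val 1 = 1 % m`: `= 1` for `m ≥ 2`, `= 0` for `m = 1` (then both angles agree modulo `2π`)
  rw [ZMod.val_one_eq_one_mod]
  rcases Nat.lt_or_ge 1 m with hm | hm
  · rw [Nat.mod_eq_of_lt hm, Nat.cast_one, mul_one]
  · have hm1 : m = 1 := le_antisymm hm (Nat.one_le_iff_ne_zero.mpr (NeZero.ne m))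
    subst hm1
    rw [Nat.mod_self, Nat.cast_zero, mul_zero, zero_div, sub_zero, Nat.cast_one, div_one, ← Real.cos_sub_two_pi]

variable {d : ℕ} (L : ℕ) [NeZero L] (M : Fin d → ℕ) [hM : ∀ μ, NeZero (M μ)]

/-- **THE BLOCK PARENT MOVES THE ANGLE BY AT MOST `2π/(n·M_{μ₀})`** (`0 ≤ ang′ − ang < 2π/(n·M)`: `val = L·⌊val/L⌋ + (val mod L)`). [folklore] -/
theorem abs_ang_sub_ang_par_le (n : ℕ) [NeZero n] (x' : Tor (fine (L * n) M)) (μ₀ : Fin d) :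
    |ang (fine (L * n) M μ₀) (x' μ₀) - ang (fine n M μ₀) (par n L M x' μ₀)| ≤ 2 * π / ((n : ℝ) * M μ₀) := by
  have hL : (0 : ℝ) < L := by exact_mod_cast Nat.pos_of_ne_zero (NeZero.ne L)
  have hn : (0 : ℝ) < n := by exact_mod_cast Nat.pos_of_ne_zero (NeZero.ne n)
  have hMμ : (0 : ℝ) < M μ₀ := by exact_mod_cast Nat.pos_of_ne_zero (NeZero.ne (M μ₀))
  have hLn : 0 < L := Nat.pos_of_ne_zero (NeZero.ne L)
  set v : ℕ := (x' μ₀).val with hv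
  have hpar : (par n L M x' μ₀).val = v / L := by rw [val_par]
  have hqr : ((v % L : ℕ) : ℝ) + (L : ℝ) * ((v / L : ℕ) : ℝ) = (v : ℝ) := by exact_mod_cast Nat.mod_add_div v L
  have hr : ((v % L : ℕ) : ℝ) < L := by exact_mod_cast Nat.mod_lt v hLn
  unfold ang
  rw [hpar]
  have e1 : ((fine (L * n) M μ₀ : ℕ) : ℝ) = (L : ℝ) * n * M μ₀ := by simp only [fine]; push_cast; ring
  have e2 : ((fine n M μ₀ : ℕ) : ℝ) = (n : ℝ) * M μ₀ := by simp only [fine]; push_cast; ring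
  rw [e1, e2]
  have e3 : 2 * π * (v : ℝ) / ((L : ℝ) * n * M μ₀) - 2 * π * ((v / L : ℕ) : ℝ) / ((n : ℝ) * M μ₀)
      = (2 * π / ((n : ℝ) * M μ₀)) * (((v % L : ℕ) : ℝ) / L) := by
    rw [← hqr]; field_simp; ring
  rw [e3, abs_of_nonneg (by positivity)]
  calc 2 * π / ((n : ℝ) * M μ₀) * (((v % L : ℕ) : ℝ) / L) ≤ 2 * π / ((n : ℝ) * M μ₀) * 1 := by
        refine mul_le_mul_of_nonneg_left ((div_le_one hL).mpr hr.le) (by positivity)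
    _ = 2 * π / ((n : ℝ) * M μ₀) := mul_one _

/-! ## §2 The lattice derivative of the profile is two-level consistent -/

/-- `|sin u − u| ≤ u³/6` for `u ≥ 0` (Mathlib's `Real.sin_le` and `Real.sin_gt_sub_cube`). [folklore] -/
theorem abs_sin_sub_self_le {u : ℝ} (hu : 0 ≤ u) : |Real.sin u - u| ≤ u ^ 3 / 6 := by
  rcases hu.eq_or_lt with h0 | hpos
  · rw [← h0]; simp
  · have h1 := Real.sin_le hu
    have h2 := Real.sin_gt_sub_cube hpos
    rw [abs_of_nonpos (by linarith)]
    linarith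

/-- `|sin t| ≤ |t|`. [folklore] -/
theorem abs_sin_le_abs (t : ℝ) : |Real.sin t| ≤ |t| := by
  simpa using Real.abs_sin_sub_sin_le t 0

/-- **THE MAIN TERM OF THE LATTICE DERIVATIVE IS TWO-LEVEL CONSISTENT**: for `0 < Ω`, `1 ≤ n ≤ n′` and angles with `|A′ − A| ≤ Ω/n`,
`|n′·(cos A′ − cos(A′ − Ω/n′)) − n·(cos A − cos(A − Ω/n))| ≤ (Ω³/12 + 3Ω²/2)/n`.  (In the witness: `Ω = 2π/M_{μ₀}`, `n = n_k`, `n′ = n_{k+1}`, `A, A′`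
the angles at the parent∕child sites; `Ω/n` = one lattice step.) [folklore] -/
theorem abs_dmain_sub_le {Ω n n' A A' : ℝ} (hΩ : 0 < Ω) (hn1 : 1 ≤ n) (hnn : n ≤ n') (hA : |A' - A| ≤ Ω / n) :
    |n' * (Real.cos A' - Real.cos (A' - Ω / n')) - n * (Real.cos A - Real.cos (A - Ω / n))|
      ≤ (Ω ^ 3 / 12 + 3 * Ω ^ 2 / 2) / n := by
  have hn : 0 < n := by linarith
  have hn' : 0 < n' := by linarith
  have hn1' : 1 ≤ n' := hn1.trans hnn
  -- product formula: `n(cos A − cos(A − h)) = −2·(n sin(h/2))·sin(A − h/2)`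
  have prod : ∀ (m B : ℝ), m * (Real.cos B - Real.cos (B - Ω / m)) = -2 * (m * Real.sin (Ω / m / 2)) * Real.sin (B - Ω / m / 2) := by
    intro m B
    rw [Real.cos_sub_cos]
    have e1 : (B + (B - Ω / m)) / 2 = B - Ω / m / 2 := by ring
    have e2 : (B - (B - Ω / m)) / 2 = Ω / m / 2 := by ring
    rw [e1, e2]; ring
  set S := n * Real.sin (Ω / n / 2) with hS
  set S' := n' * Real.sin (Ω / n' / 2) with hS'
  set T := Real.sin (A - Ω / n / 2) with hT
  set T' := Real.sin (A' - Ω / n' / 2) with hT'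
  rw [prod n' A', prod n A, ← hS, ← hS', ← hT, ← hT']
  -- `|S − Ω/2| ≤ Ω³/(48 n²) ≤ Ω³/(48 n)`, same for `S′`
  have hSΩ : ∀ (m : ℝ), 1 ≤ m → |m * Real.sin (Ω / m / 2) - Ω / 2| ≤ Ω ^ 3 / 48 / m := by
    intro m hm
    have hm0 : 0 < m := by linarith
    have hu : 0 ≤ Ω / m / 2 := by positivity
    have h := abs_sin_sub_self_le hu
    have e : m * Real.sin (Ω / m / 2) - Ω / 2 = m * (Real.sin (Ω / m / 2) - Ω / m / 2) := by field_simp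
    rw [e, abs_mul, abs_of_pos hm0]
    calc m * |Real.sin (Ω / m / 2) - Ω / m / 2| ≤ m * ((Ω / m / 2) ^ 3 / 6) := mul_le_mul_of_nonneg_left h hm0.le
      _ = Ω ^ 3 / 48 / m * (1 / m) := by field_simp; ring
      _ ≤ Ω ^ 3 / 48 / m * 1 := by
          refine mul_le_mul_of_nonneg_left ?_ (by positivity)
          rw [div_le_one hm0]; exact hm
      _ = Ω ^ 3 / 48 / m := mul_one _
  have hS1 := hSΩ n hn1
  have hS2 := hSΩ n' hn1'
  have hS2' : Ω ^ 3 / 48 / n' ≤ Ω ^ 3 / 48 / n := div_le_div_of_nonneg_left (by positivity) hn hnn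
  have hSS : |S' - S| ≤ Ω ^ 3 / 24 / n := by
    calc |S' - S| = |(S' - Ω / 2) - (S - Ω / 2)| := by ring_nf
      _ ≤ |S' - Ω / 2| + |S - Ω / 2| := abs_sub _ _
      _ ≤ Ω ^ 3 / 48 / n + Ω ^ 3 / 48 / n := add_le_add (hS2.trans hS2') hS1
      _ = Ω ^ 3 / 24 / n := by ring
  -- `|S| ≤ Ω/2`, `|T′| ≤ 1`
  have hSle : |S| ≤ Ω / 2 := by
    rw [hS, abs_mul, abs_of_pos hn]
    calc n * |Real.sin (Ω / n / 2)| ≤ n * |Ω / n / 2| := mul_le_mul_of_nonneg_left (abs_sin_le_abs _) hn.le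
      _ = Ω / 2 := by rw [abs_of_nonneg (by positivity)]; field_simp
  have hT'1 : |T'| ≤ 1 := Real.abs_sin_le_one _
  -- `|T′ − T| ≤ |A′ − A| + (h − h′)/2 ≤ 3Ω/(2n)`
  have hh : 0 ≤ Ω / n - Ω / n' := sub_nonneg.mpr (div_le_div_of_nonneg_left hΩ.le hn hnn)
  have hΩn' : 0 ≤ Ω / n' := by positivity
  have hh' : Ω / n - Ω / n' ≤ Ω / n := by linarith
  have hTT : |T' - T| ≤ 3 * Ω / 2 / n := by
    calc |T' - T| ≤ |(A' - Ω / n' / 2) - (A - Ω / n / 2)| := Real.abs_sin_sub_sin_le _ _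
      _ = |(A' - A) + (Ω / n - Ω / n') / 2| := by ring_nf
      _ ≤ |A' - A| + |(Ω / n - Ω / n') / 2| := abs_add_le _ _
      _ ≤ Ω / n + (Ω / n) / 2 := add_le_add hA (by rw [abs_of_nonneg (by linarith)]; linarith)
      _ = 3 * Ω / 2 / n := by ring
  -- assemble: `S′T′ − ST = (S′ − S)T′ + S(T′ − T)`
  have e : -2 * S' * T' - -2 * S * T = -2 * ((S' - S) * T' + S * (T' - T)) := by ring
  rw [e, abs_mul, show |(-2 : ℝ)| = 2 by norm_num]
  have h1 : |(S' - S) * T'| ≤ Ω ^ 3 / 24 / n * 1 := by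
    rw [abs_mul]; exact mul_le_mul hSS hT'1 (abs_nonneg _) (by positivity)
  have h2 : |S * (T' - T)| ≤ Ω / 2 * (3 * Ω / 2 / n) := by
    rw [abs_mul]; exact mul_le_mul hSle hTT (abs_nonneg _) (by positivity)
  calc 2 * |(S' - S) * T' + S * (T' - T)| ≤ 2 * (|(S' - S) * T'| + |S * (T' - T)|) :=
        mul_le_mul_of_nonneg_left (abs_add_le _ _) (by norm_num)
    _ ≤ 2 * (Ω ^ 3 / 24 / n * 1 + Ω / 2 * (3 * Ω / 2 / n)) := mul_le_mul_of_nonneg_left (add_le_add h1 h2) (by norm_num)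
    _ = (Ω ^ 3 / 12 + 3 * Ω ^ 2 / 2) / n := by field_simp; ring

end Summit.QuantumFields.BalabanUV.T4Continuum.LatticeCosineProfileDiff

end
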